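import Summits.CriticalPhenomena.SAWScalingLimit.Theorems.SAWDefectDecoherenceMassRatioRenewalSurgeryA

/-!
# Renewal surgery for the box kernel, part B: the inequalities (A), (B) and `stub_renewalSurgery`

Crux `SAWDefectDecoherence.MassRatio` (stmt-CriticalPhenomena-8550), line `renewal-averaging-at-b`.
This file proves the registered stub **`stub_renewalSurgery : RenewalSurgery kernel`** — Kesten's
bridge decomposition in the box as the two finite inequalities of
`Theorems/SAWDefectDecoherenceMassRatioRenewalDefs.lean`:

* (A) `partA`: `irrMassOf kernel m p h V + Σ_{k<t} Σ_{|j|≤V} kernel m p k V k j · irrMassOf kernel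
  (m+k) (p+j) (h-k) V ≤ Σ_{|J| ≤ 2V} kernel m p t (2V) h J` — an irreducible upper bridge of height
  `h-k` (translated door `(m+k, p+j)`) stacked on a lower `k`-bridge, `1 ≤ k < t`, is a box walk
  of height `h` in the window-doubled box with NO renewal level in `[t, h)` (`append_mem_VS`,
  `noSplit_append`); together with the irreducible bridges of full height these inject
  (`conc_injOn`), weights multiply;
* (B) `partB`: `bridgeMassOf kernel m p s W ≤ irrMassOf kernel m p s W + Σ_{k<s} Σ_{|j|≤W}
  kernel m p k W k j · irrMassOf kernel (m+k) (p+j) (s-k) (2W)` — a reducible bridge splits at its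
  HIGHEST renewal level `k` (`Nat.findGreatest`) into a lower `k`-bridge and an IRREDUCIBLE upper
  piece living in the translated, window-doubled box (`exists_conc_eq`); as this is the inverse
  of concatenation, injectivity is again `conc_injOn`.

Walks are read from the top mid-edge down to the door; the junction of the two pieces is the
vertical edge `top m p k j = {(m+k, p+j), (m+k-1, p+j)}` (= the translated door up to orientation).
The parity hypothesis `(p - m) % 2 = 0` of `RenewalSurgery` is not needed.  Sources: H. Kesten,
J. Math. Phys. 4 (1963) 960–969; N. Madras, G. Slade, *The Self-Avoiding Walk* (1993) §4.2
(4.2.5).  Toolkit: part A (`…RenewalSurgeryA.lean`).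
-/

noncomputable section

namespace Summit.CriticalPhenomena.SAWScalingLimit.Theorems.MassRatio.Renewal

open Literature.Probability.LatticeModels Literature.Probability.RandomPlanarGeometry
open Literature.Probability.RandomPlanarGeometry.SAW
open Summit.CriticalPhenomena.SAWScalingLimit.Theorems.MassRatio.Negative

namespace Surgery

/-! ### (A) Concatenation -/

/-- **Concatenation**: an upper box walk of height `h - k` on the translated door `(m+k, p+j)`
stacked on a lower box walk of height `k` from `top m p k j` is a box walk of height `h` in the
window-doubled box, from `top m p h (j + j')`. [folklore] -/
theorem append_mem_VS {m p : ℤ} {h k V : ℕ} {j j' : ℤ} (hk : 1 ≤ k) (hkh : k < h)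
    {l l' : List HexVertex} (hl : l ∈ VS (box m p k V) (top m p k j) (door m p))
    (hl' : l' ∈ VS (box (m + k) (p + j) (h - k) V) (top (m + k) (p + j) (h - k) j')
      (door (m + k) (p + j))) :
    l' ++ l ∈ VS (box m p h (2 * V)) (top m p h (j + j')) (door m p) := by
  have hhk : 1 ≤ h - k := by omega
  have hneL := ne_nil_of_mem hl hk
  have hneU := ne_nil_of_mem hl' hhk
  have hheadL := head?_of_mem hl hk
  have hheadU := head?_of_mem hl' hhk
  have hlastL := getLast?_of_mem hl hk
  have hlastU := getLast?_of_mem hl' hhk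
  have hjV := offset_of_mem hl hk
  have hj'V := offset_of_mem hl' hhk
  have hadjU := adj_of_mem hl'
  have hadjL := adj_of_mem hl
  have hrowL := rows_of_mem hl
  have hrowU := rows_of_mem hl'
  rw [List.head?_eq_some_head hneL, Option.some_inj] at hheadL
  rw [List.head?_eq_some_head hneU, Option.some_inj] at hheadU
  rw [List.getLast?_eq_some_getLast hneL, Option.some_inj] at hlastL
  rw [List.getLast?_eq_some_getLast hneU, Option.some_inj] at hlastU
  obtain ⟨βL, rfl⟩ := mem_VS.1 hl
  obtain ⟨βU, rfl⟩ := mem_VS.1 hl'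
  refine mem_VS.2 ⟨mkSAW (box m p h (2 * V)) (bv (m + h) (p + (j + j')))
    (bv (m + h - 1) (p + (j + j'))) (door m p) (βU.verts ++ βL.verts) (by simp [hneU])
    ?_ ?_ ?_ ?_ ?_ ?_ ?_ ?_ ?_ (fun heq => top_outer_not_mem_door (j + j') (show 1 ≤ h by omega)
      (by rw [← heq]; exact Sym2.mem_mk_left _ _)), rfl⟩
  · -- inside the big box
    intro v hv
    refine mem_Rect.2 ?_
    rcases List.mem_append.1 hv with hv | hv
    · have := hrowU v hv; push_cast at this ⊢; omega
    · have := hrowL v hv; push_cast at this ⊢; omega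
  · -- self-avoiding
    refine List.nodup_append.2 ⟨βU.nodup, βL.nodup, fun a ha b hb hab => ?_⟩
    have h1 := hrowU a ha
    have h2 := hrowL b hb
    rw [hab] at h1
    omega
  · -- chain, junction edge `= top m p k j`
    refine List.isChain_append.2 ⟨βU.isChain, βL.isChain, fun x hx y hy => ?_⟩
    rw [List.getLast?_eq_some_getLast hneU, Option.mem_def, Option.some_inj] at hx
    rw [List.head?_eq_some_head hneL, Option.mem_def, Option.some_inj] at hy
    rw [← hx, ← hy, hlastU, hheadL]
    exact hadjL
  · -- head
    rw [List.head_append_of_ne_nil hneU, hheadU]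
    congr 1 <;> omega
  · -- last
    rw [List.getLast_append_of_ne_nil _ hneL, hlastL]
    exact Sym2.mem_mk_right _ _
  · -- the top mid-edge is an edge
    have e1 : bv (m + ↑k + ↑(h - k)) (p + j + j') = bv (m + h) (p + (j + j')) := by
      congr 1 <;> omega
    have e2 : bv (m + ↑k + ↑(h - k) - 1) (p + j + j') = bv (m + h - 1) (p + (j + j')) := by
      congr 1 <;> omega
    rw [← e1, ← e2]
    exact hadjU
  · refine bv_mem_Rect.2 ?_; push_cast; omega
  · intro hu
    rcases List.mem_append.1 hu with hu | hu
    · have := hrowU _ hu; rw [row_bv] at this; omega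
    · have := hrowL _ hu; rw [row_bv] at this; omega
  · refine ⟨bv (m - 1) p, Sym2.mem_mk_left _ _, fun hu => ?_⟩
    rcases List.mem_append.1 hu with hu | hu
    · have := hrowU _ hu; rw [row_bv] at this; omega
    · have := hrowL _ hu; rw [row_bv] at this; omega

/-- **Inequality (A)**: irreducible bridges of height `h`, and irreducible `(h-k)`-bridges stacked
on `k`-bridges (`1 ≤ k < t`), inject into the box walks of height `h` with no renewal level in
`[t, h)` (window doubled), preserving the `x_c`-weight. [folklore] -/
theorem partA (m p : ℤ) (t V h : ℕ) (ht : 1 ≤ t) (hth : t ≤ h) :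
    irrMassOf kernel m p h V + ∑ k ∈ Finset.Icc 1 (t - 1), ∑ j ∈ Finset.Icc (-(V : ℤ)) V,
        kernel m p k V k j * irrMassOf kernel (m + k) (p + j) (h - k) V
      ≤ ∑ j ∈ Finset.Icc (-((2 * V : ℕ) : ℤ)) ((2 * V : ℕ) : ℤ), kernel m p t (2 * V) h j := by
  classical
  have hx0 : 0 ≤ hexCriticalFugacity := hexCriticalFugacity_pos_lt_one.1.le
  have hVV : box m p h V ⊆ box m p h (2 * V) := fun v hv => by
    have := mem_Rect.1 hv
    refine mem_Rect.2 ?_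
    push_cast at this ⊢
    omega
  rw [sum_kernel_eq m p t (2 * V) h,
    ← Finset.sum_filter_add_sum_filter_not (TGT m p (2 * V) h _)
      (fun y : Σ _ : ℤ, List HexVertex => NoSplit m 1 h y.2)]
  refine add_le_add ?_ ?_
  · -- irreducible bridges of full height, transported `V → 2V`
    calc irrMassOf kernel m p h V
        = ∑ y ∈ (TGT m p V h (Finset.Icc (-(V : ℤ)) V)).filter
            (fun y : Σ _ : ℤ, List HexVertex => NoSplit m 1 h y.2),
            hexCriticalFugacity ^ y.2.length := by
          rw [Finset.sum_filter]; exact sum_kernel_eq m p 1 V h _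
      _ ≤ _ := by
        refine sum_le_sum_of_injOn id (Set.injOn_id _) ?_ ?_ ?_
        · intro y hy
          rw [Finset.mem_filter, mem_TGT, Finset.mem_Icc] at hy
          dsimp only [id]
          rw [Finset.mem_filter, mem_TGT, Finset.mem_Icc]
          exact ⟨⟨by push_cast; omega, mem_VS_mono hVV hy.1.2⟩, hy.2⟩
        · intro y hy
          rw [Finset.mem_filter] at hy
          exact le_of_eq (if_pos fun h' _ h2 => hy.2 h' (by omega) h2).symm
        · intro y _
          split_ifs
          exacts [pow_nonneg hx0 _, le_rfl]
  · -- concatenations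
    rw [sum_kernel_mul_irr_eq]
    refine sum_le_sum_of_injOn conc (conc_injOn fun k hk => ?_) ?_ ?_ ?_
    · rw [Finset.mem_Icc] at hk; omega
    · rintro ⟨k, j, l, j', l'⟩ hx
      simp only [mem_SRC, Finset.mem_Icc] at hx
      obtain ⟨hk, hj, hl, hj', hl', hirr⟩ := hx
      have hjV := offset_of_mem hl hk.1
      have hj'V := offset_of_mem hl' (by omega)
      rw [Finset.mem_filter, mem_TGT]
      refine ⟨⟨?_, append_mem_VS hk.1 (by omega) hl hl'⟩, fun hns => hns k hk.1 (by omega)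
        ⟨l', l, rfl, fun v hv => (rows_of_mem hl' v hv).1, fun v hv => by
          have := (rows_of_mem hl v hv).2.1; omega⟩⟩
      simp only [conc, Finset.mem_Icc]; push_cast; omega
    · rintro ⟨k, j, l, j', l'⟩ hx
      simp only [mem_SRC, Finset.mem_Icc] at hx
      obtain ⟨hk, hj, hl, hj', hl', hirr⟩ := hx
      have hns : NoSplit m t h (l' ++ l) :=
        noSplit_append (by omega) (fun v hv => by have := (rows_of_mem hl v hv).2.1; omega) hirr
      simp only [conc, wt, if_pos hns, List.length_append, pow_add]
      rw [mul_comm]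
    · intro y _
      split_ifs
      exacts [pow_nonneg hx0 _, le_rfl]

/-! ### (B) Splitting at the highest renewal level -/

/-- **Splitting**: a reducible box walk of height `s` (window `W`) is the concatenation of an
irreducible upper piece (in the translated, window-doubled box) and a lower bridge, cut at its
highest renewal level. [folklore] -/
theorem exists_conc_eq {m p : ℤ} {s W : ℕ} {J : ℤ} (hs : 1 ≤ s) {L : List HexVertex}
    (hL : L ∈ VS (box m p s W) (top m p s J) (door m p)) (hred : ¬ NoSplit m 1 s L) :
    ∃ x ∈ SRC m p W (2 * W) s (Finset.Icc 1 (s - 1)), conc x = ⟨J, L⟩ := by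
  classical
  -- the highest renewal level `k`
  obtain ⟨h₀, h₀1, h₀s, hsp₀⟩ : ∃ h₀, 1 ≤ h₀ ∧ h₀ < s ∧ Splits m h₀ L := by
    by_contra hcon
    push Not at hcon
    exact hred fun h' h1 h2 => hcon h' h1 h2
  set k := Nat.findGreatest (fun h' => Splits m h' L) (s - 1) with hk_def
  have hk : Splits m k L :=
    Nat.findGreatest_spec (P := fun h' => Splits m h' L) (by omega : h₀ ≤ s - 1) hsp₀
  have hk1 : 1 ≤ k :=
    le_trans h₀1 (Nat.le_findGreatest (P := fun h' => Splits m h' L) (by omega) hsp₀)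
  have hks : k ≤ s - 1 := Nat.findGreatest_le _
  have hmax : ∀ h', k < h' → h' < s → ¬ Splits m h' L := fun h' h1 h2 =>
    Nat.findGreatest_is_greatest (P := fun h' => Splits m h' L) h1 (by omega)
  obtain ⟨l₁, l₂, he, hl₁, hl₂⟩ := hk
  have hrow := rows_of_mem hL
  have hne := ne_nil_of_mem hL hs
  have hhead := head?_of_mem hL hs
  have hlast := getLast?_of_mem hL hs
  have hJ := offset_of_mem hL hs
  obtain ⟨β, rfl⟩ := mem_VS.1 hL
  -- both pieces are nonempty
  have hne₂ : l₂ ≠ [] := by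
    intro h0
    have hmem : bv m p ∈ l₁ := by
      have := List.mem_of_getLast? hlast
      rwa [he, h0, List.append_nil] at this
    have := hl₁ _ hmem
    rw [row_bv] at this
    omega
  have hne₁ : l₁ ≠ [] := by
    intro h0
    have hmem : bv (m + s - 1) (p + J) ∈ l₂ := by
      have := List.mem_of_head? hhead
      rwa [he, h0, List.nil_append] at this
    have := hl₂ _ hmem
    rw [row_bv] at this
    omega
  -- the junction is a vertical edge at rows `m+k`, `m+k-1`
  have hch : (l₁ ++ l₂).IsChain hexGraph.Adj := he ▸ β.isChain
  have hnd : (l₁ ++ l₂).Nodup := he ▸ β.nodup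
  have hadj : hexGraph.Adj (l₁.getLast hne₁) (l₂.head hne₂) :=
    (List.isChain_append.1 hch).2.2 _ (by rw [List.getLast?_eq_some_getLast hne₁]; rfl) _
      (by rw [List.head?_eq_some_head hne₂]; rfl)
  have hu := hl₁ _ (List.getLast_mem hne₁)
  have hv := hl₂ _ (List.head_mem hne₂)
  have hruv : row (l₁.getLast hne₁) = m + k ∧ row (l₂.head hne₂) = m + k - 1 ∧
      pos (l₁.getLast hne₁) = pos (l₂.head hne₂) := by
    rcases (adj_iff _ _).1 hadj with ⟨h1, -⟩ | ⟨h1, h2, -⟩ | ⟨h1, h2, -⟩ <;> omega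
  set j := pos (l₂.head hne₂) - p with hj_def
  have hv_eq : l₂.head hne₂ = bv (m + k - 1) (p + j) := by
    rw [← bv_row_pos (l₂.head hne₂)]; congr 1 <;> omega
  have hu_eq : l₁.getLast hne₁ = bv (m + k) (p + j) := by
    rw [← bv_row_pos (l₁.getLast hne₁)]; congr 1 <;> omega
  have hvbox := hrow _ (he ▸ List.mem_append_right l₁ (List.head_mem hne₂))
  rw [he, List.head?_append, List.head?_eq_some_head hne₁, Option.some_or,
    Option.some_inj] at hhead
  refine ⟨⟨k, j, l₂, J - j, l₁⟩, ?_, ?_⟩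
  swap
  · show (⟨j + (J - j), l₁ ++ l₂⟩ : Σ _ : ℤ, List HexVertex) = ⟨J, β.verts⟩
    rw [he]; congr 1; ring
  simp only [mem_SRC]
  refine ⟨Finset.mem_Icc.2 ⟨hk1, hks⟩, by omega, ?_, by push_cast; omega, ?_, ?_⟩
  · -- the lower bridge
    refine mem_VS.2 ⟨mkSAW (box m p k W) (bv (m + k) (p + j)) (bv (m + k - 1) (p + j)) (door m p)
      l₂ hne₂ ?_ (List.nodup_append.1 hnd).2.1 (List.isChain_append.1 hch).2.1 hv_eq ?_ ?_ ?_ ?_ ?_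
      (fun heq => top_outer_not_mem_door j hk1 (by rw [← heq]; exact Sym2.mem_mk_left _ _)), rfl⟩
    · intro v hv'
      have h1 := hrow v (he ▸ List.mem_append_right l₁ hv')
      have h2 := hl₂ v hv'
      refine mem_Rect.2 ?_
      omega
    · refine β.getLast_mem _ ?_
      rw [he, List.getLast?_eq_some_getLast (by simp [hne₂]), List.getLast_append_of_ne_nil _ hne₂]
    · rw [← hu_eq, ← hv_eq]; exact hadj
    · refine bv_mem_Rect.2 ?_; omega
    · intro hu'
      have := hl₂ _ hu'; rw [row_bv] at this; omega
    · refine ⟨bv (m - 1) p, Sym2.mem_mk_left _ _, fun hu' => ?_⟩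
      have := hrow _ (he ▸ List.mem_append_right l₁ hu'); rw [row_bv] at this; omega
  · -- the upper piece, in the translated window-doubled box
    refine mem_VS.2 ⟨mkSAW (box (m + k) (p + j) (s - k) (2 * W))
      (bv (m + k + ((s - k : ℕ) : ℤ)) (p + j + (J - j)))
      (bv (m + k + ((s - k : ℕ) : ℤ) - 1) (p + j + (J - j))) (door (m + k) (p + j)) l₁ hne₁ ?_
      (List.nodup_append.1 hnd).1 (List.isChain_append.1 hch).1 ?_ ?_ ?_ ?_ ?_ ?_
      (fun heq => top_outer_not_mem_door (m := m + k) (p := p + j) (J - j)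
        (show 1 ≤ s - k by omega) (by rw [← heq]; exact Sym2.mem_mk_left _ _)), rfl⟩
    · intro v hv'
      have h1 := hrow v (he ▸ List.mem_append_left l₂ hv')
      have h2 := hl₁ v hv'
      refine mem_Rect.2 ?_
      push_cast
      omega
    · rw [hhead]; congr 1 <;> omega
    · rw [hu_eq]; exact Sym2.mem_mk_right _ _
    · have e1 : (m + ↑k + ↑(s - k) : ℤ) = m + s := by omega
      have e2 : p + j + (J - j) = p + J := by ring
      rw [e1, e2]
      exact adj_of_mem hL
    · refine bv_mem_Rect.2 ?_; push_cast; omega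
    · intro hu'
      have := hrow _ (he ▸ List.mem_append_left l₂ hu'); rw [row_bv] at this; omega
    · refine ⟨bv (m + k - 1) (p + j), Sym2.mem_mk_left _ _, fun hu' => ?_⟩
      have := hl₁ _ hu'; rw [row_bv] at this; omega
  · -- irreducibility of the upper piece = maximality of `k`
    intro h' h1 h2 hsp
    refine hmax (k + h') (by omega) (by omega) ?_
    rw [he]
    exact splits_append_right (splits_relevel (by push_cast; ring) hsp) fun v hv' => by
      have := hl₂ v hv'; push_cast; omega

/-- **Inequality (B)**: bridges of height `s` are irreducible or split, at their highest renewal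
level `k ∈ [1, s)`, into a lower `k`-bridge and an irreducible upper `(s-k)`-bridge of the
translated window-doubled box, injectively and weight-preservingly. [folklore] -/
theorem partB (m p : ℤ) (s W : ℕ) (hs : 1 ≤ s) :
    bridgeMassOf kernel m p s W ≤ irrMassOf kernel m p s W +
      ∑ k ∈ Finset.Icc 1 (s - 1), ∑ j ∈ Finset.Icc (-(W : ℤ)) W,
        kernel m p k W k j * irrMassOf kernel (m + k) (p + j) (s - k) (2 * W) := by
  classical
  have hx0 : 0 ≤ hexCriticalFugacity := hexCriticalFugacity_pos_lt_one.1.le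
  have hB : bridgeMassOf kernel m p s W =
      ∑ y ∈ TGT m p W s (Finset.Icc (-(W : ℤ)) W), hexCriticalFugacity ^ y.2.length := by
    unfold bridgeMassOf
    rw [sum_kernel_eq]
    exact Finset.sum_congr rfl fun y _ => if_pos (noSplit_self _ _ _)
  rw [hB, ← Finset.sum_filter_add_sum_filter_not (TGT m p W s _)
    (fun y : Σ _ : ℤ, List HexVertex => NoSplit m 1 s y.2)]
  refine add_le_add (le_of_eq ?_) ?_
  · rw [Finset.sum_filter]
    exact (sum_kernel_eq m p 1 W s _).symm
  · rw [sum_kernel_mul_irr_eq]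
    refine sum_le_sum_of_surjOn conc (conc_injOn fun k hk => ?_) ?_ ?_ fun y => pow_nonneg hx0 _
    · rw [Finset.mem_Icc] at hk; omega
    · rintro ⟨J, L⟩ hy
      rw [Finset.mem_filter, mem_TGT] at hy
      exact exists_conc_eq hs hy.1.2 hy.2
    · intro x _
      simp only [conc, wt, List.length_append, pow_add]
      rw [mul_comm]

end Surgery

/-- **Stub 3b — renewal surgery** (Kesten's bridge decomposition in the box, as the two finite
inequalities `RenewalSurgery kernel`): (A) concatenating an irreducible upper bridge with a lower
bridge of height `k < t` gives, injectively, a box walk with no renewal level in `[t, h)`;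
(B) splitting a bridge at its highest renewal level gives a lower bridge and an irreducible
upper piece in the translated, window-doubled box. Kesten (1963); Madras–Slade (1993) §4.2.
[folklore] -/
theorem stub_renewalSurgery : RenewalSurgery kernel :=
  ⟨fun m p t V h _ ht hth => Surgery.partA m p t V h ht hth,
    fun m p s W _ hs => Surgery.partB m p s W hs⟩

end Summit.CriticalPhenomena.SAWScalingLimit.Theorems.MassRatio.Renewal
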